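import Mathlib
import HarnessLib
import Literature.MathematicalPhysics.QuantumLattice.GaugeGroups
import Literature.LinearAlgebra.Matrix.UnitaryGroupMaximalTorus
import Literature.LinearAlgebra.Matrix.SpecialUnitaryGroupConjugacyClasses
import Summits.Ventures.LatticeQCDFlow.Exactness.TorusCircleChart
import Summits.Ventures.LatticeQCDFlow.Exactness.TorusCubeChart
import Summits.Ventures.LatticeQCDFlow.Exactness.TorusWeylSymmetry
import Summits.Ventures.LatticeQCDFlow.Exactness.SpectralKernelJacobianWeylShapeSU
import Summits.Ventures.LatticeQCDFlow.Exactness.SU3AlcoveFundamentalDomain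

/-!
# Haar on the diagonal torus of `SU(3)` by Weyl chambers: `Haar_{SΔ(3)} = Σ_{σ ∈ S₃} (P_σ ∘ E)_* ((2π)⁻² · Leb|_A)` — the alcove `A` is a fundamental domain up to the six phase permutations

HONEST FRAMING: exact (Metropolis-corrected) sampling algorithms for lattice gauge theory;
figures of merit are autocorrelation/cost numbers at stated couplings and volumes; no
continuum-physics claim.

Venture `LatticeQCDFlow` (cell pub-lqcd), topic `Exactness`; FANOUT row 10 (`eng-equiv`, engine
`latflow.equiv` `spectral.py` `N = 3`: `canonicalise` moves the eigen-phases into the cell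
`x₁ < x₂ < x₃ < x₁ + 2π` and remembers the permutation, `uncanonicalise` applies it back — the torus
map is the Weyl-equivariant extension of a map of ONE chamber; Boyda et al., PRD 103 (2021) 074504
§III.C, App. B).  NEW WORK of the cell over this row's `SU3AlcoveFundamentalDomain.lean`,
`TorusCubeChart.lean`, `TorusCircleChart.lean`, `TorusWeylSymmetry.lean` and Mathlib
(`Real.map_matrix_volume_pi_eq_smul_volume_pi`).  Nothing is cited as a fact; no number; no
definition (`E`, `P σ`, `C τ` enter through characterising hypotheses `hE`, `hP`, `hC` and existence
theorems).  STEP 2b of the `N = 3` alcove programme (LEANMAP-eng-equiv-gen8 §C′).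

## What is typed (`x(θ) = (θ₀, θ₁, −θ₀−θ₁)`; `E θ = diag(e^{i x(θ)})`; `(P σ t)_ii = t_{σi σi}`;
`C τ = {θ | x(θ)(τ0) < x(θ)(τ1) < x(θ)(τ2) < x(θ)(τ0) + 2π}`, `A = C 1`)

* `specialDiagonalTorus_ext`; `exists_angleChart_su3`, `coe_angleChart_su3`, `continuous_measurable_angleChart_su3`,
  `angleChart_su3_eq_of_exp_eq`, `angleChart_su3_add`, `angleChart_su3_intMul_add` (lattice periodicity);
* **`haarProbability_su3Torus_eq_map_cube`** — `Haar_{SΔ(3)} = (2π)⁻² · E_* Leb|_{(−π,π]²}`;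
* `exists_permDiag_family_su3`; `phases_su3_perm`, **`permDiag_angleChart_su3`** (`P σ ∘ E = E ∘ L_σ`),
  `preimage_chamber_perm_su3` (`L_σ⁻¹ (C τ) = C (σ τ)`), **`map_linPerm_volume_su3`** (`|det L_σ| = 1`);
* **`haarProbability_su3Torus_eq_sum_chambers`** — `Haar_{SΔ(3)} = Σ_{σ ∈ S₃} (P σ)_* ((2π)⁻² · E_* Leb|_{C 1})`.
NOT here: the Jacobian consequences (`SU3TorusAlcoveJacobian.lean`); `N ≥ 4`; any number. -/

noncomputable section

namespace Summit.Ventures.LatticeQCDFlow.Exactness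

open MeasureTheory Matrix Set Real
open Literature.LinearAlgebra.Matrix
open Literature.MathematicalPhysics.QuantumFieldTheory (haarProbability)
open scoped ENNReal

/-- Two elements of `SΔ(n)` with the same diagonal entries are equal. -/
theorem specialDiagonalTorus_ext {n : Type*} [Fintype n] [DecidableEq n] {t s : specialDiagonalTorus n}
    (h : ∀ i, ((t : Matrix.specialUnitaryGroup n ℂ) : Matrix n n ℂ) i i =
      ((s : Matrix.specialUnitaryGroup n ℂ) : Matrix n n ℂ) i i) : t = s := by
  apply Subtype.ext
  apply Subtype.ext
  rw [coe_specialDiagonalTorus_eq_diagonal t, coe_specialDiagonalTorus_eq_diagonal s]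
  exact congrArg diagonal (funext h)

/-! ## The angle chart of `SΔ(3)` on the free phases -/

/-- `diag(e^{iθ₀}, e^{iθ₁}, e^{−i(θ₀+θ₁)}) ∈ SU(3)`. -/
theorem diagonal_phases_su3_mem (θ : Fin 2 → ℝ) :
    diagonal (fun i => (Circle.exp ((![θ 0, θ 1, -(θ 0 + θ 1)] : Fin 3 → ℝ) i) : ℂ)) ∈
      Matrix.specialUnitaryGroup (Fin 3) ℂ := by
  refine (Literature.MathematicalPhysics.QuantumLattice.diagonal_mem_specialUnitaryGroup_iff _).mpr
    ⟨fun i => Circle.norm_coe _, ?_⟩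
  rw [Fin.prod_univ_three]
  simp only [Matrix.cons_val_zero, Matrix.cons_val_one, Matrix.cons_val_two, Matrix.tail_cons,
    Matrix.head_cons]
  rw [← Circle.coe_mul, ← Circle.coe_mul, ← Circle.exp_add, ← Circle.exp_add,
    show θ 0 + θ 1 + -(θ 0 + θ 1) = 0 by ring, Circle.exp_zero, Circle.coe_one]

/-- **The angle chart of `SΔ(3)` exists and is continuous**: `θ ↦ diag(e^{iθ₀}, e^{iθ₁}, e^{−i(θ₀+θ₁)})`. -/
theorem exists_angleChart_su3 :
    ∃ E : (Fin 2 → ℝ) → specialDiagonalTorus (Fin 3), Continuous E ∧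
      ∀ θ (i : Fin 3), (((E θ : specialDiagonalTorus (Fin 3)) : Matrix.specialUnitaryGroup (Fin 3) ℂ) :
        Matrix (Fin 3) (Fin 3) ℂ) i i = (Circle.exp ((![θ 0, θ 1, -(θ 0 + θ 1)] : Fin 3 → ℝ) i) : ℂ) := by
  refine ⟨fun θ => ⟨⟨diagonal (fun i => (Circle.exp ((![θ 0, θ 1, -(θ 0 + θ 1)] : Fin 3 → ℝ) i) : ℂ)),
    diagonal_phases_su3_mem θ⟩, ⟨_, rfl⟩⟩, ?_, fun θ i => ?_⟩
  · refine continuous_induced_rng.2 (continuous_induced_rng.2 ?_)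
    change Continuous fun θ : Fin 2 → ℝ =>
      diagonal (fun i => (Circle.exp ((![θ 0, θ 1, -(θ 0 + θ 1)] : Fin 3 → ℝ) i) : ℂ))
    exact (continuous_pi fun i => continuous_subtype_val.comp
      (Circle.exp.continuous.comp ((continuous_apply i).comp continuous_phases_su3))).matrix_diagonal
  · change (diagonal (fun i => (Circle.exp ((![θ 0, θ 1, -(θ 0 + θ 1)] : Fin 3 → ℝ) i) : ℂ))) i i = _
    rw [diagonal_apply_eq]

section Chart

variable {E : (Fin 2 → ℝ) → specialDiagonalTorus (Fin 3)}
  (hE : ∀ θ (i : Fin 3), (((E θ : specialDiagonalTorus (Fin 3)) : Matrix.specialUnitaryGroup (Fin 3) ℂ) :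
    Matrix (Fin 3) (Fin 3) ℂ) i i = (Circle.exp ((![θ 0, θ 1, -(θ 0 + θ 1)] : Fin 3 → ℝ) i) : ℂ))

include hE

/-- The matrix of `E θ` is `diag(e^{i x(θ)})`. -/
theorem coe_angleChart_su3 (θ : Fin 2 → ℝ) :
    (((E θ : specialDiagonalTorus (Fin 3)) : Matrix.specialUnitaryGroup (Fin 3) ℂ) : Matrix (Fin 3) (Fin 3) ℂ) =
      diagonal (fun i => (Circle.exp ((![θ 0, θ 1, -(θ 0 + θ 1)] : Fin 3 → ℝ) i) : ℂ)) := by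
  rw [coe_specialDiagonalTorus_eq_diagonal (E θ)]
  exact congrArg diagonal (funext fun i => hE θ i)

/-- **The angle chart is continuous and measurable.** -/
theorem continuous_measurable_angleChart_su3 : Continuous E ∧ Measurable E := by
  haveI : SecondCountableTopology (specialDiagonalTorus (Fin 3)) := secondCountableTopology_specialDiagonalTorus
  refine (fun h : Continuous E => ⟨h, h.measurable⟩) ?_
  refine continuous_induced_rng.2 (continuous_induced_rng.2 ?_)
  have hfun : (fun θ => (((E θ : specialDiagonalTorus (Fin 3)) : Matrix.specialUnitaryGroup (Fin 3) ℂ) :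
      Matrix (Fin 3) (Fin 3) ℂ)) =
      fun θ : Fin 2 → ℝ => diagonal (fun i => (Circle.exp ((![θ 0, θ 1, -(θ 0 + θ 1)] : Fin 3 → ℝ) i) : ℂ)) :=
    funext fun θ => coe_angleChart_su3 hE θ
  change Continuous fun θ => (((E θ : specialDiagonalTorus (Fin 3)) : Matrix.specialUnitaryGroup (Fin 3) ℂ) :
    Matrix (Fin 3) (Fin 3) ℂ)
  rw [hfun]
  exact (continuous_pi fun i => continuous_subtype_val.comp
    (Circle.exp.continuous.comp ((continuous_apply i).comp continuous_phases_su3))).matrix_diagonal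

/-- **The angle chart only sees the free phases modulo `2π`**: if `e^{iθ_k} = e^{iθ'_k}` for
`k = 0, 1` then `E θ = E θ'`. -/
theorem angleChart_su3_eq_of_exp_eq {θ θ' : Fin 2 → ℝ} (h0 : Circle.exp (θ 0) = Circle.exp (θ' 0))
    (h1 : Circle.exp (θ 1) = Circle.exp (θ' 1)) : E θ = E θ' := by
  refine specialDiagonalTorus_ext fun i => ?_
  rw [hE, hE]
  fin_cases i
  · simpa using congrArg Subtype.val h0
  · simpa using congrArg Subtype.val h1
  · simp only [Fin.reduceFinMk, Matrix.cons_val_two, Matrix.tail_cons, Matrix.head_cons, neg_add_rev,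
      Circle.exp_add, Circle.exp_neg, h0, h1]

/-- **The angle chart is additive**: `E (θ + θ') = E θ · E θ'`. -/
theorem angleChart_su3_add (θ θ' : Fin 2 → ℝ) : E (θ + θ') = E θ * E θ' := by
  refine specialDiagonalTorus_ext fun i => ?_
  have hmul : (((E θ * E θ' : specialDiagonalTorus (Fin 3)) : Matrix.specialUnitaryGroup (Fin 3) ℂ) :
      Matrix (Fin 3) (Fin 3) ℂ) =
      (((E θ : specialDiagonalTorus (Fin 3)) : Matrix.specialUnitaryGroup (Fin 3) ℂ) : Matrix (Fin 3) (Fin 3) ℂ) *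
        (((E θ' : specialDiagonalTorus (Fin 3)) : Matrix.specialUnitaryGroup (Fin 3) ℂ) : Matrix (Fin 3) (Fin 3) ℂ) :=
    rfl
  rw [hmul, coe_angleChart_su3 hE, coe_angleChart_su3 hE, coe_angleChart_su3 hE, diagonal_mul_diagonal,
    diagonal_apply_eq, diagonal_apply_eq, ← Circle.coe_mul, ← Circle.exp_add]
  congr 3
  fin_cases i
  · simp
  · simp
  · simp; ring

/-- **Lattice periodicity**: an integer translation `θ ↦ 2πm + θ` does not change `E θ`. -/
theorem angleChart_su3_intMul_add (m : Fin 2 → ℤ) (θ : Fin 2 → ℝ) :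
    E ((fun k => (m k : ℝ) * (2 * π)) + θ) = E θ := by
  refine angleChart_su3_eq_of_exp_eq hE ?_ ?_
  · simp only [Pi.add_apply, Circle.exp_add, Circle.exp_int_mul_two_pi, one_mul]
  · simp only [Pi.add_apply, Circle.exp_add, Circle.exp_int_mul_two_pi, one_mul]

/-- **`Haar_{SΔ(3)}` in the free angle coordinates**: `Haar_{SΔ(3)} = (2π)⁻² · E_* Leb|_{(−π, π]²}`.
Proof: `z ↦ E(arg z₀, arg z₁)` is a measurable surjective homomorphism `U(1)² → SΔ(3)`, so it
presents Haar (uniqueness), and `⊗ Haar_{U(1)}` is the normalised angle cube. -/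
theorem haarProbability_su3Torus_eq_map_cube :
    haarProbability (specialDiagonalTorus (Fin 3)) = ((ENNReal.ofReal (2 * π)) ^ 2)⁻¹ •
      Measure.map E ((volume : Measure (Fin 2 → ℝ)).restrict (Set.pi Set.univ fun _ : Fin 2 => Ioc (-π) π)) := by
  haveI : SecondCountableTopology (specialDiagonalTorus (Fin 3)) := secondCountableTopology_specialDiagonalTorus
  have hEm : Measurable E := (continuous_measurable_angleChart_su3 hE).2
  -- the chart read on `U(1)²` through the argument
  have hargm : Measurable fun z : Fin 2 → Circle => fun k => Complex.arg (z k : ℂ) := by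
    refine measurable_pi_lambda _ fun k => ?_
    have hk : Measurable fun z : Fin 2 → Circle => z k := measurable_pi_apply k
    have hc : Continuous fun z : Circle => (z : ℂ) := continuous_subtype_val
    exact Complex.measurable_arg.comp (hc.measurable.comp hk)
  have hmeas : Measurable fun z : Fin 2 → Circle => E fun k => Complex.arg (z k : ℂ) := hEm.comp hargm
  have hmul : ∀ z w : Fin 2 → Circle, E (fun k => Complex.arg ((z * w) k : ℂ)) =
      E (fun k => Complex.arg (z k : ℂ)) * E (fun k => Complex.arg (w k : ℂ)) := by
    intro z w
    rw [← angleChart_su3_add hE]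
    refine angleChart_su3_eq_of_exp_eq hE ?_ ?_
    · simp only [Pi.mul_apply, Pi.add_apply, Circle.exp_add, Circle.exp_arg]
    · simp only [Pi.mul_apply, Pi.add_apply, Circle.exp_add, Circle.exp_arg]
  have hsurj : Function.Surjective fun z : Fin 2 → Circle => E fun k => Complex.arg (z k : ℂ) := by
    intro t
    have hd1 : ∀ i, ‖((t : Matrix.specialUnitaryGroup (Fin 3) ℂ) : Matrix (Fin 3) (Fin 3) ℂ) i i‖ = 1 :=
      norm_specialDiagonalTorus_apply t
    have hprod : ((t : Matrix.specialUnitaryGroup (Fin 3) ℂ) : Matrix (Fin 3) (Fin 3) ℂ) 0 0 *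
        ((t : Matrix.specialUnitaryGroup (Fin 3) ℂ) : Matrix (Fin 3) (Fin 3) ℂ) 1 1 *
          ((t : Matrix.specialUnitaryGroup (Fin 3) ℂ) : Matrix (Fin 3) (Fin 3) ℂ) 2 2 = 1 := by
      have h := (norm_eq_one_and_prod_eq_one_of_mem_specialDiagonalTorus (coe_specialDiagonalTorus_eq_diagonal t)).2
      rw [Fin.prod_univ_three] at h
      exact h
    set c0 : Circle := ⟨((t : Matrix.specialUnitaryGroup (Fin 3) ℂ) : Matrix (Fin 3) (Fin 3) ℂ) 0 0,
      mem_sphere_zero_iff_norm.mpr (hd1 0)⟩ with hc0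
    set c1 : Circle := ⟨((t : Matrix.specialUnitaryGroup (Fin 3) ℂ) : Matrix (Fin 3) (Fin 3) ℂ) 1 1,
      mem_sphere_zero_iff_norm.mpr (hd1 1)⟩ with hc1
    have h2 : ((t : Matrix.specialUnitaryGroup (Fin 3) ℂ) : Matrix (Fin 3) (Fin 3) ℂ) 2 2 = (((c0 * c1)⁻¹ : Circle) : ℂ) := by
      rw [Circle.coe_inv, Circle.coe_mul, hc0, hc1]
      exact eq_inv_of_mul_eq_one_right hprod
    refine ⟨![c0, c1], specialDiagonalTorus_ext fun i => ?_⟩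
    change ((((E fun k => Complex.arg (((![c0, c1] : Fin 2 → Circle) k : Circle) : ℂ)) : specialDiagonalTorus (Fin 3)) :
      Matrix.specialUnitaryGroup (Fin 3) ℂ) : Matrix (Fin 3) (Fin 3) ℂ) i i =
        ((t : Matrix.specialUnitaryGroup (Fin 3) ℂ) : Matrix (Fin 3) (Fin 3) ℂ) i i
    rw [hE]
    fin_cases i
    · show ((Circle.exp (Complex.arg (c0 : ℂ)) : Circle) : ℂ) = (c0 : ℂ)
      rw [Circle.exp_arg]
    · show ((Circle.exp (Complex.arg (c1 : ℂ)) : Circle) : ℂ) = (c1 : ℂ)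
      rw [Circle.exp_arg]
    · show ((Circle.exp (-(Complex.arg (c0 : ℂ) + Complex.arg (c1 : ℂ))) : Circle) : ℂ) =
        ((t : Matrix.specialUnitaryGroup (Fin 3) ℂ) : Matrix (Fin 3) (Fin 3) ℂ) 2 2
      rw [Circle.exp_neg, Circle.exp_add, Circle.exp_arg, Circle.exp_arg, h2]
  have hpres := map_eq_haarProbability_of_mul_of_surjective
    (Measure.pi fun _ : Fin 2 => haarProbability Circle) hmeas hmul hsurj
  -- `⊗ Haar_{U(1)}` is the normalised angle cube, and `E ∘ arg ∘ exp = E`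
  have hcomp : (fun z : Fin 2 → Circle => E fun k => Complex.arg (z k : ℂ)) ∘
      (fun θ : Fin 2 → ℝ => fun k => Circle.exp (θ k)) = E := by
    funext θ
    simp only [Function.comp_apply]
    exact angleChart_su3_eq_of_exp_eq hE (by rw [Circle.exp_arg]) (by rw [Circle.exp_arg])
  rw [← hpres, pi_haarProbability_circle_eq_map_cube, Measure.map_smul, Measure.map_map hmeas measurable_cubeExp,
    hcomp, Fintype.card_fin, ← Measure.restrict_pi_pi, ← volume_pi]

end Chart

/-! ## The phase permutations read on the free phases -/

/-- **The family of phase permutations of `SΔ(3)` exists**, each continuous. -/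
theorem exists_permDiag_family_su3 :
    ∃ P : Equiv.Perm (Fin 3) → specialDiagonalTorus (Fin 3) → specialDiagonalTorus (Fin 3),
      (∀ σ, Continuous (P σ)) ∧ ∀ σ t i,
        (((P σ t : specialDiagonalTorus (Fin 3)) : Matrix.specialUnitaryGroup (Fin 3) ℂ) : Matrix (Fin 3) (Fin 3) ℂ) i i =
          ((t : Matrix.specialUnitaryGroup (Fin 3) ℂ) : Matrix (Fin 3) (Fin 3) ℂ) (σ i) (σ i) :=
  ⟨fun σ => Classical.choose (exists_permDiag_specialDiagonalTorus σ),
    fun σ => (Classical.choose_spec (exists_permDiag_specialDiagonalTorus σ)).1,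
    fun σ => (Classical.choose_spec (exists_permDiag_specialDiagonalTorus σ)).2⟩

/-- **A permutation of the three eigen-phases, read on the free phases**: the phases of
`(x(θ)(σ0), x(θ)(σ1))` are `x(θ) ∘ σ` (the third follows from `Σ = 0`). -/
theorem phases_su3_perm (σ : Equiv.Perm (Fin 3)) (θ : Fin 2 → ℝ) (i : Fin 3) :
    (![(![(![θ 0, θ 1, -(θ 0 + θ 1)] : Fin 3 → ℝ) (σ 0), (![θ 0, θ 1, -(θ 0 + θ 1)] : Fin 3 → ℝ) (σ 1)] : Fin 2 → ℝ) 0,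
        (![(![θ 0, θ 1, -(θ 0 + θ 1)] : Fin 3 → ℝ) (σ 0), (![θ 0, θ 1, -(θ 0 + θ 1)] : Fin 3 → ℝ) (σ 1)] : Fin 2 → ℝ) 1,
        -((![(![θ 0, θ 1, -(θ 0 + θ 1)] : Fin 3 → ℝ) (σ 0), (![θ 0, θ 1, -(θ 0 + θ 1)] : Fin 3 → ℝ) (σ 1)] : Fin 2 → ℝ) 0 +
          (![(![θ 0, θ 1, -(θ 0 + θ 1)] : Fin 3 → ℝ) (σ 0), (![θ 0, θ 1, -(θ 0 + θ 1)] : Fin 3 → ℝ) (σ 1)] : Fin 2 → ℝ) 1)] :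
        Fin 3 → ℝ) i =
      (![θ 0, θ 1, -(θ 0 + θ 1)] : Fin 3 → ℝ) (σ i) := by
  have hsum : ∑ j, (![θ 0, θ 1, -(θ 0 + θ 1)] : Fin 3 → ℝ) (σ j) = 0 := by
    rw [Equiv.sum_comp σ (fun j => (![θ 0, θ 1, -(θ 0 + θ 1)] : Fin 3 → ℝ) j)]
    exact sum_phases_su3 θ
  rw [Fin.sum_univ_three] at hsum
  fin_cases i
  · simp
  · simp
  · simp only [Fin.reduceFinMk, Matrix.cons_val_two, Matrix.tail_cons, Matrix.head_cons, Matrix.cons_val_zero,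
      Matrix.cons_val_one]
    linarith

section Perm

variable {E : (Fin 2 → ℝ) → specialDiagonalTorus (Fin 3)}
  (hE : ∀ θ (i : Fin 3), (((E θ : specialDiagonalTorus (Fin 3)) : Matrix.specialUnitaryGroup (Fin 3) ℂ) :
    Matrix (Fin 3) (Fin 3) ℂ) i i = (Circle.exp ((![θ 0, θ 1, -(θ 0 + θ 1)] : Fin 3 → ℝ) i) : ℂ))
  {P : Equiv.Perm (Fin 3) → specialDiagonalTorus (Fin 3) → specialDiagonalTorus (Fin 3)}
  (hP : ∀ σ t i,
    (((P σ t : specialDiagonalTorus (Fin 3)) : Matrix.specialUnitaryGroup (Fin 3) ℂ) : Matrix (Fin 3) (Fin 3) ℂ) i i =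
      ((t : Matrix.specialUnitaryGroup (Fin 3) ℂ) : Matrix (Fin 3) (Fin 3) ℂ) (σ i) (σ i))

include hE hP

/-- **The phase permutation on the chart is the linear map `L_σ`**:
`P σ (E θ) = E (x(θ)(σ0), x(θ)(σ1))`. -/
theorem permDiag_angleChart_su3 (σ : Equiv.Perm (Fin 3)) (θ : Fin 2 → ℝ) :
    P σ (E θ) = E (![(![θ 0, θ 1, -(θ 0 + θ 1)] : Fin 3 → ℝ) (σ 0), (![θ 0, θ 1, -(θ 0 + θ 1)] : Fin 3 → ℝ) (σ 1)]) := by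
  refine specialDiagonalTorus_ext fun i => ?_
  rw [hP, hE, hE, phases_su3_perm]

end Perm

section Chambers

variable {C : Equiv.Perm (Fin 3) → Set (Fin 2 → ℝ)}
  (hC : ∀ τ θ, θ ∈ C τ ↔
    (![θ 0, θ 1, -(θ 0 + θ 1)] : Fin 3 → ℝ) (τ 0) < (![θ 0, θ 1, -(θ 0 + θ 1)] : Fin 3 → ℝ) (τ 1) ∧
      (![θ 0, θ 1, -(θ 0 + θ 1)] : Fin 3 → ℝ) (τ 1) < (![θ 0, θ 1, -(θ 0 + θ 1)] : Fin 3 → ℝ) (τ 2) ∧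
        (![θ 0, θ 1, -(θ 0 + θ 1)] : Fin 3 → ℝ) (τ 2) < (![θ 0, θ 1, -(θ 0 + θ 1)] : Fin 3 → ℝ) (τ 0) + 2 * π)

include hC

/-- **`L_σ⁻¹ (C τ) = C (σ τ)`**: the linear map of a phase permutation carries chambers to chambers. -/
theorem preimage_chamber_perm_su3 (σ τ : Equiv.Perm (Fin 3)) :
    (fun θ : Fin 2 → ℝ =>
      (![(![θ 0, θ 1, -(θ 0 + θ 1)] : Fin 3 → ℝ) (σ 0), (![θ 0, θ 1, -(θ 0 + θ 1)] : Fin 3 → ℝ) (σ 1)] : Fin 2 → ℝ)) ⁻¹'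
        C τ = C (σ * τ) := by
  ext θ
  rw [Set.mem_preimage, hC, hC, phases_su3_perm, phases_su3_perm, phases_su3_perm, Equiv.Perm.mul_apply,
    Equiv.Perm.mul_apply, Equiv.Perm.mul_apply]

end Chambers

/-- **`L_σ` preserves Lebesgue measure**: the linear map `θ ↦ (x(θ)(σ0), x(θ)(σ1))` is given by an
integer matrix of determinant `±1`. -/
theorem map_linPerm_volume_su3 (σ : Equiv.Perm (Fin 3)) :
    Measure.map (fun θ : Fin 2 → ℝ =>
      (![(![θ 0, θ 1, -(θ 0 + θ 1)] : Fin 3 → ℝ) (σ 0), (![θ 0, θ 1, -(θ 0 + θ 1)] : Fin 3 → ℝ) (σ 1)] : Fin 2 → ℝ))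
        (volume : Measure (Fin 2 → ℝ)) = volume := by
  set M : Matrix (Fin 2) (Fin 2) ℝ := Matrix.of ![(![![(1 : ℝ), 0], ![0, 1], ![-1, -1]] : Fin 3 → Fin 2 → ℝ) (σ 0),
    (![![(1 : ℝ), 0], ![0, 1], ![-1, -1]] : Fin 3 → Fin 2 → ℝ) (σ 1)] with hM
  have hfun : (Matrix.toLin' M : (Fin 2 → ℝ) → (Fin 2 → ℝ)) = fun θ : Fin 2 → ℝ =>
      (![(![θ 0, θ 1, -(θ 0 + θ 1)] : Fin 3 → ℝ) (σ 0), (![θ 0, θ 1, -(θ 0 + θ 1)] : Fin 3 → ℝ) (σ 1)] : Fin 2 → ℝ) := by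
    funext θ
    rw [Matrix.toLin'_apply]
    funext k
    fin_cases k
    · simp [hM, Matrix.mulVec, dotProduct, Fin.sum_univ_two]
      generalize σ 0 = a
      fin_cases a <;> simp
      ring
    · simp [hM, Matrix.mulVec, dotProduct, Fin.sum_univ_two]
      generalize σ 1 = a
      fin_cases a <;> simp
      ring
  have habs : |M.det| = 1 := by
    rw [Matrix.det_fin_two]
    have hne : σ 0 ≠ σ 1 := σ.injective.ne (by decide)
    simp only [hM, Matrix.of_apply, Matrix.cons_val_zero, Matrix.cons_val_one]
    generalize σ 0 = a at hne ⊢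
    generalize σ 1 = b at hne ⊢
    fin_cases a <;> fin_cases b <;> simp_all
  have hdet : M.det ≠ 0 := fun h => by simp [h] at habs
  rw [← hfun, Real.map_matrix_volume_pi_eq_smul_volume_pi hdet, abs_inv, habs, inv_one, ENNReal.ofReal_one,
    one_smul]

/-! ## The decomposition of Haar by chambers -/

section Decomposition

variable {E : (Fin 2 → ℝ) → specialDiagonalTorus (Fin 3)}
  (hE : ∀ θ (i : Fin 3), (((E θ : specialDiagonalTorus (Fin 3)) : Matrix.specialUnitaryGroup (Fin 3) ℂ) :
    Matrix (Fin 3) (Fin 3) ℂ) i i = (Circle.exp ((![θ 0, θ 1, -(θ 0 + θ 1)] : Fin 3 → ℝ) i) : ℂ))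
  {P : Equiv.Perm (Fin 3) → specialDiagonalTorus (Fin 3) → specialDiagonalTorus (Fin 3)}
  (hP : ∀ σ t i,
    (((P σ t : specialDiagonalTorus (Fin 3)) : Matrix.specialUnitaryGroup (Fin 3) ℂ) : Matrix (Fin 3) (Fin 3) ℂ) i i =
      ((t : Matrix.specialUnitaryGroup (Fin 3) ℂ) : Matrix (Fin 3) (Fin 3) ℂ) (σ i) (σ i))
  {C : Equiv.Perm (Fin 3) → Set (Fin 2 → ℝ)}
  (hC : ∀ τ θ, θ ∈ C τ ↔
    (![θ 0, θ 1, -(θ 0 + θ 1)] : Fin 3 → ℝ) (τ 0) < (![θ 0, θ 1, -(θ 0 + θ 1)] : Fin 3 → ℝ) (τ 1) ∧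
      (![θ 0, θ 1, -(θ 0 + θ 1)] : Fin 3 → ℝ) (τ 1) < (![θ 0, θ 1, -(θ 0 + θ 1)] : Fin 3 → ℝ) (τ 2) ∧
        (![θ 0, θ 1, -(θ 0 + θ 1)] : Fin 3 → ℝ) (τ 2) < (![θ 0, θ 1, -(θ 0 + θ 1)] : Fin 3 → ℝ) (τ 0) + 2 * π)

include hE hP hC

/-- **Haar on the diagonal torus of `SU(3)` by Weyl chambers.**  With the angle chart `E`, the
phase permutations `P σ` and the alcove `A = C 1 = {θ | θ₀ < θ₁ < −θ₀−θ₁ < θ₀ + 2π}` in free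
eigen-phases:
`Haar_{SΔ(3)} = Σ_{σ ∈ S₃} (P σ)_* ((2π)⁻² · E_* Leb|_A)`.
The alcove is a fundamental domain of `Haar_{SΔ(3)}` up to the six phase permutations (the walls
being null) — the hypothesis `hdecomp` of `hasJacobian_of_symmetric_pieces'`. -/
theorem haarProbability_su3Torus_eq_sum_chambers :
    haarProbability (specialDiagonalTorus (Fin 3)) =
      ∑ σ : Equiv.Perm (Fin 3), Measure.map (P σ)
        (((ENNReal.ofReal (2 * π)) ^ 2)⁻¹ • Measure.map E ((volume : Measure (Fin 2 → ℝ)).restrict (C 1))) := by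
  haveI : SecondCountableTopology (specialDiagonalTorus (Fin 3)) := secondCountableTopology_specialDiagonalTorus
  have hEm : Measurable E := (continuous_measurable_angleChart_su3 hE).2
  have hPm : ∀ σ, Measurable (P σ) := fun σ => (permDiag_surjective_continuous (hP σ)).2.measurable
  have hLm : ∀ σ : Equiv.Perm (Fin 3), Measurable fun θ : Fin 2 → ℝ =>
      (![(![θ 0, θ 1, -(θ 0 + θ 1)] : Fin 3 → ℝ) (σ 0), (![θ 0, θ 1, -(θ 0 + θ 1)] : Fin 3 → ℝ) (σ 1)] : Fin 2 → ℝ) :=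
    fun σ => (continuous_pi fun k => by
      fin_cases k
      · simpa [Function.comp_def] using (continuous_apply (σ 0)).comp continuous_phases_su3
      · simpa [Function.comp_def] using (continuous_apply (σ 1)).comp continuous_phases_su3).measurable
  have hCm : ∀ τ, MeasurableSet (C τ) := measurableSet_chamber_su3 hC
  rw [haarProbability_su3Torus_eq_map_cube hE]
  ext B hB
  -- the lattice-invariant measurable set `S = E⁻¹ B`
  have hS : MeasurableSet (E ⁻¹' B) := hEm hB
  have hinv : ∀ m : Fin 2 → ℤ, (fun θ : Fin 2 → ℝ => (fun k => (m k : ℝ) * (2 * π)) + θ) ⁻¹' (E ⁻¹' B) = E ⁻¹' B := by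
    intro m
    ext θ
    simp only [Set.mem_preimage, angleChart_su3_intMul_add hE]
  -- left side: `(2π)⁻² Leb(S ∩ Q)`
  rw [Measure.smul_apply, Measure.map_apply hEm hB, Measure.restrict_apply hS,
    volume_inter_cube_eq_sum_chambers_su3 hC hS hinv, Measure.coe_finsetSum, Finset.sum_apply, smul_eq_mul,
    Finset.mul_sum]
  -- right side, chamber by chamber: `(P σ)_* (c · E_* Leb|_{C 1}) (B) = c · Leb(S ∩ C σ⁻¹)`
  have hterm : ∀ σ : Equiv.Perm (Fin 3),
      (Measure.map (P σ) (((ENNReal.ofReal (2 * π)) ^ 2)⁻¹ • Measure.map E ((volume : Measure (Fin 2 → ℝ)).restrict (C 1)))) B =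
        ((ENNReal.ofReal (2 * π)) ^ 2)⁻¹ * volume (E ⁻¹' B ∩ C σ⁻¹) := by
    intro σ
    rw [Measure.map_apply (hPm σ) hB, Measure.smul_apply, Measure.map_apply hEm (hPm σ hB), smul_eq_mul,
      Measure.restrict_apply (hEm (hPm σ hB))]
    congr 1
    -- `E⁻¹ (P σ)⁻¹ B ∩ C 1 = L_σ⁻¹ (S ∩ C σ⁻¹)` and `L_σ` preserves Lebesgue measure
    have hset : E ⁻¹' (P σ ⁻¹' B) ∩ C 1 =
        (fun θ : Fin 2 → ℝ =>
          (![(![θ 0, θ 1, -(θ 0 + θ 1)] : Fin 3 → ℝ) (σ 0), (![θ 0, θ 1, -(θ 0 + θ 1)] : Fin 3 → ℝ) (σ 1)] :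
            Fin 2 → ℝ)) ⁻¹' (E ⁻¹' B ∩ C σ⁻¹) := by
      rw [Set.preimage_inter, preimage_chamber_perm_su3 hC σ σ⁻¹, mul_inv_cancel]
      congr 1
      ext θ
      simp only [Set.mem_preimage, permDiag_angleChart_su3 hE hP]
    rw [hset, ← Measure.map_apply (hLm σ) (hS.inter (hCm _)), map_linPerm_volume_su3]
  simp_rw [hterm]
  exact Fintype.sum_equiv (Equiv.inv (Equiv.Perm (Fin 3))) _ _ fun σ => rfl

end Decomposition

end Summit.Ventures.LatticeQCDFlow.Exactness
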